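import Summits.QuantumFields.BalabanUV.Beta.FP.CoarseJetUnitGraded
import Summits.QuantumFields.BalabanUV.Beta.FP.RelInvPeriodisedCombRecord

/-!
# `BalabanUV.Beta.FP.CoarseJetUnitGradedComb` — road «FP» (binder row D1), ROUTE T, presentation T-β, option (δ) «LIFT ∕ GRADED» (R-FP-54′), the (J-a) dictionary's item
# **(γ-sym)**, LEVEL-UP KIT: **THE TORUS CALL's GRADED COARSE TERM READ ONE LEVEL UP, FOR THE CHART-(III′) TABLES** — leaf-05 g28's `CoarseJetUnitGraded.torus_coarse_secondVar_of_hId_graded`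
# re-read at `𝕄′_j = bhKStepSh d Lc (Dsh Lc) j` on `fine Lc M′` and `H′₀ := (perF M′ (bhKStepSh d Lc (Dsh Lc) (j+1)))∘(fields, fields)`, order 0 discharged by
# `RelInvPeriodisedCombRecord.hId_order_zero_record_comb`, orders 1–2 (`hId₁ hId₂`) DISPLAYED

HONEST DEPENDENCY (page 1, mandatory): continuum YM on T⁴ ⇐ BetaPertH ∧ nine spine estimates (0/9 proved); BetaPertH ⇐ (D1) ∧ (D4) ∧
CAP+tail; G-an2-4 gates asym, D1 and NE2/3/4.  HONEST FRAMING (cell contract, verbatim): «discharging `BetaPertH` makes Bałaban's UV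
stability UNCONDITIONAL — a real constructive-QFT result; it is NOT the continuum limit and NOT the Clay problem.»  ABSOLUTE RULE (cell
charter, verbatim): «No internally-minted statement may enter as a cited fact. Every hypothesis is either kernel-proved in this package or a
verbatim quotation of a PUBLISHED theorem with page reference. The manuscript(s) under audit are NOT citable for their own disputed steps — they
are the thing under adjudication; programme-internal (2001/route/tribunal) claims are never citable.»

CONTENT: `torus_coarse_secondVar_of_hId_graded_comb` — the generic §1 of `CoarseJetUnitGraded` (`secondVar_coarse_of_hId_graded`) fed the chart-(III′) order-0 identification; root
`ρ_c = ctr (d+1) Lc`, coarse multipliers by `(p̄, κ) ↦ (cp p̄, inr κ)`, `cp p̄ = Lc • p̄`; every `d`, `Lc ≥ 1`, EVERY level `j`.  [folklore] a three-line reading; nothing of an1's ∕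
an2's ∕ leaf-02's ∕ leaf-03's restated; no `Prop`, no `def`, nothing cited, 0 sorry; discharges NO binder of row D1; NOT the dictionary's `hId₁ ∕ hId₂` (displayed), NOT (J-a), NOT (T-ID),
NOT SDF, NOT D1, NOT BetaPertH, NOT continuum, NOT Clay; 0 estimates.  Unit `b2b-balaban-beta-d1-formalise-leaf-05` (gen 29), 2026-08-22; no existing file touched.
-/

noncomputable section

open scoped BigOperators Matrix

namespace Summit.QuantumFields.BalabanUV.Beta.FP.CoarseJetUnitGradedComb

open Matrix
open Literature.Probability.LatticeModels (Torus.proj)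
open Literature.MathematicalPhysics.QuantumFieldTheory.Balaban1983to89
open Literature.MathematicalPhysics.QuantumFieldTheory.Balaban1983to89.Beta
open Literature.MathematicalPhysics.QuantumFieldTheory.Balaban1983to89.Beta.Composition (kkt)
open Literature.MathematicalPhysics.QuantumFieldTheory.Balaban1983to89.Beta.CompositionSingular (effForm)
open B5Prop11Plancherel (fine)
open B6Lemma24Torus (pbox)
open AffineAveraging (Site box toSite)
open AveragingContoursRooted (ctr ctrOff)
open OneStepResolventKernel (Fib)
open BalabanStepJetsSucc (wVH)
open Summit.QuantumFields.BalabanUV.Beta.SymShiftedSpread (bhKStepSh)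
open Summit.QuantumFields.BalabanUV.Beta.DshAn1 (Dsh)
open Summit.QuantumFields.BalabanUV.Beta.D1BFx.LogDetSecondVariation (secondVar)
open Summit.QuantumFields.BalabanUV.Beta.FP.KernelPeriodisationFib (Idx perF)
open Summit.QuantumFields.BalabanUV.Beta.FP.TorusCombRows (Res combRowsT)
open Summit.QuantumFields.BalabanUV.Beta.FP.RelInvPeriodisedEffFormCoarse (wVH_pos)
open Summit.QuantumFields.BalabanUV.Beta.FP.RelInvPeriodisedCombRecord (hId_order_zero_record_comb)
open Summit.QuantumFields.BalabanUV.Beta.FP.CoarseJetUnitGraded (secondVar_coarse_of_hId_graded)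

/-! ## §2 At the chart-(III′) record -/

section Record

variable {d : ℕ} {Lc : ℕ} [NeZero Lc] (M' : Fin (d + 1) → ℕ) [∀ i, NeZero (M' i)]

set_option synthInstance.maxSize 1024 in
/-- **[folklore] THE TORUS CALL's GRADED COARSE TERM READ ONE LEVEL UP** — `torus_coarse_secondVar_of_hId_graded` AT THE CHART-(III′) TABLES: same index types of record, binders (`j cp hcp hfμ hcoarse`, the call's `hH₀ hQ₁₀ hτ₁`, `hS`, free coarse border ∕ slice
`Q₂₀ Q₂₁ Q₂₂ τ₂`, DISPLAYED `hId₁ : E₁ = (wVH d Lc (j+1))⁻¹ • H'₁`, `hId₂ : E₂ = (wVH d Lc (j+1))⁻¹ • H'₂`), `H'₀ := (perF M′ (bhKStepSh d Lc (Dsh Lc) (j+1)))∘(fields, fields)`;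
order 0 by `RelInvPeriodisedCombRecord.hId_order_zero_record_comb`, the unit removed by `secondVar_coarse_of_hId_graded`. -/
theorem torus_coarse_secondVar_of_hId_graded_comb (j : ℕ)
    (cp : ↥(pbox M') → ↥(pbox (fine Lc M'))) (hcp : ∀ p : ↥(pbox M'), (cp p : Site (d + 1)) = (Lc : ℤ) • (p : Site (d + 1)))
    (hfμ : Function.Injective (fun a : ↥(pbox M') × Fin (d + 1) => ((cp a.1, Sum.inr a.2) : Idx (fine Lc M') (Fib d))))
    (hcoarse : ∀ (s : ↥(pbox (fine Lc M'))) (m : Fin (d + 1)),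
      ((s, Sum.inr m) : Idx (fine Lc M') (Fib d)) ∈ Set.range (fun a : ↥(pbox M') × Fin (d + 1) => ((cp a.1, Sum.inr a.2) : Idx (fine Lc M') (Fib d)))
        ↔ Torus.proj Lc (s : Site (d + 1)) = 0)
    -- the fine objects of the torus call, by defining equations (p313662 verbatim)
    {H₀ : Matrix (↥(pbox (fine Lc M')) × Fin (d + 1)) (↥(pbox (fine Lc M')) × Fin (d + 1)) ℝ}
    {Q₁₀ : Matrix (↥(pbox M') × Fin (d + 1)) (↥(pbox (fine Lc M')) × Fin (d + 1)) ℝ}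
    {τ₁ : Matrix (Res (ctr (d + 1) Lc) Lc (fine Lc M')) (↥(pbox (fine Lc M')) × Fin (d + 1)) ℝ}
    (hH₀ : H₀ = (perF (fine Lc M') (bhKStepSh d Lc (Dsh Lc) j)).submatrix
        (fun b : ↥(pbox (fine Lc M')) × Fin (d + 1) => ((b.1, Sum.inl b.2) : Idx (fine Lc M') (Fib d)))
        (fun b : ↥(pbox (fine Lc M')) × Fin (d + 1) => ((b.1, Sum.inl b.2) : Idx (fine Lc M') (Fib d))))
    (hQ₁₀ : Q₁₀ = (perF (fine Lc M') (bhKStepSh d Lc (Dsh Lc) j)).submatrix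
        (fun a : ↥(pbox M') × Fin (d + 1) => ((cp a.1, Sum.inr a.2) : Idx (fine Lc M') (Fib d)))
        (fun b : ↥(pbox (fine Lc M')) × Fin (d + 1) => ((b.1, Sum.inl b.2) : Idx (fine Lc M') (Fib d))))
    (hτ₁ : τ₁ = (combRowsT (ctr (d + 1) Lc) Lc (fine Lc M')).submatrix id
        (fun b : ↥(pbox (fine Lc M')) × Fin (d + 1) => ((b.1, Sum.inl b.2) : Idx (fine Lc M') (Fib d))))
    {S : Matrix ((↥(pbox M') × Fin (d + 1)) ⊕ Res (ctr (d + 1) Lc) Lc (fine Lc M')) ((↥(pbox M') × Fin (d + 1)) ⊕ Res (ctr (d + 1) Lc) Lc (fine Lc M')) ℝ}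
    (hS : effForm H₀ (fromRows Q₁₀ τ₁) = S)
    -- the coarse border and slice of the torus call (free here)
    {κ ρ₂ : Type*} [Fintype κ] [DecidableEq κ] [Fintype ρ₂] [DecidableEq ρ₂]
    (Q₂₀ Q₂₁ Q₂₂ : Matrix κ (↥(pbox M') × Fin (d + 1)) ℝ) (τ₂ : Matrix ρ₂ (↥(pbox M') × Fin (d + 1)) ℝ)
    -- the dictionary at orders 1–2, DISPLAYED
    {E₁ E₂ H'₁ H'₂ : Matrix (↥(pbox M') × Fin (d + 1)) (↥(pbox M') × Fin (d + 1)) ℝ}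
    (hId₁ : E₁ = (wVH d Lc (j + 1))⁻¹ • H'₁) (hId₂ : E₂ = (wVH d Lc (j + 1))⁻¹ • H'₂) :
    secondVar (kkt S.toBlocks₁₁ (fromRows Q₂₀ τ₂))
        (fromBlocks E₁ (-(fromRows Q₂₁ (0 : Matrix ρ₂ (↥(pbox M') × Fin (d + 1)) ℝ))ᵀ)
          (fromRows Q₂₁ (0 : Matrix ρ₂ (↥(pbox M') × Fin (d + 1)) ℝ)) 0)
        (kkt E₂ (fromRows Q₂₂ (0 : Matrix ρ₂ (↥(pbox M') × Fin (d + 1)) ℝ)))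
      = secondVar
          (kkt ((perF M' (bhKStepSh d Lc (Dsh Lc) (j + 1))).submatrix
              (fun b : ↥(pbox M') × Fin (d + 1) => ((b.1, Sum.inl b.2) : Idx M' (Fib d)))
              (fun b : ↥(pbox M') × Fin (d + 1) => ((b.1, Sum.inl b.2) : Idx M' (Fib d))))
            (fromRows Q₂₀ τ₂))
          (fromBlocks H'₁ (-(fromRows Q₂₁ (0 : Matrix ρ₂ (↥(pbox M') × Fin (d + 1)) ℝ))ᵀ)
            (fromRows Q₂₁ (0 : Matrix ρ₂ (↥(pbox M') × Fin (d + 1)) ℝ)) 0)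
          (kkt H'₂ (fromRows Q₂₂ (0 : Matrix ρ₂ (↥(pbox M') × Fin (d + 1)) ℝ))) := by
  have hw : (wVH d Lc (j + 1))⁻¹ ≠ 0 := inv_ne_zero (wVH_pos (d := d) (Nat.pos_of_ne_zero (NeZero.ne Lc)) (j + 1)).ne'
  have hId₀ := hId_order_zero_record_comb M' j cp hcp hfμ hcoarse
  rw [← hS, hH₀, hQ₁₀, hτ₁]
  exact secondVar_coarse_of_hId_graded hw Q₂₀ Q₂₁ Q₂₂ τ₂ hId₀ hId₁ hId₂

end Record

end Summit.QuantumFields.BalabanUV.Beta.FP.CoarseJetUnitGradedComb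

end
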